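import Mathlib
import HarnessLib
import Literature.MathematicalPhysics.QuantumFieldTheory.YangMillsOS
import Summits.QuantumFields.YangMills.Theorems.MirrorModularBoostsHypercubicLimitCouplingResponseDefsC
import Summits.QuantumFields.YangMills.Theorems.LangevinControlUVOSLegsFromFemtoAndGapStubAssemblyStrings

/-!
# Line `Sketch` (coupling response): plane-string distributions and their limits (Defs F, reshape 4 vocabulary)

Definitions file for crux `stmt-QuantumFields-16154` (`HypercubicLimit`), line `Sketch`.  The closure is cut at the level of
continuous linear functionals on `𝓢((ℝ⁴)ⁿ, ℂ)`:
* `planeDist r sch k n q` — the RENORMALISED lattice `n`-point distribution of the plane string `q : Fin n → Plane` at step `k`: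
  `(c_k a_k⁴)ⁿ ·` the sibling toolkit's `latticeDistStr` of the string of plaquette observables with counterterms `m_k/6`
  (so that on a real tensor `⊗ fᵢ` it is `∫ ∏ᵢ Φ^{qᵢ}_k(fᵢ) dμ_k`);
* `UniformFunctionalBoundPlanes r sch` — the `k`-uniform E0′-type bound on `⁰𝒮` for all plane strings (the target of the smeared →
  functional step Z1);
* `PlaneLimits r sch φ T` — along the subsequence `φ` every plane-string distribution converges on `⁰𝒮` to `T n q`, and the limits obey
  one E0′-type bound everywhere (the output of the compactness step Z2);
* `planeSum T` — the candidate one-field Schwinger family of the curvature, `Σ_q T n q`.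
Nothing is asserted.
-/

noncomputable section

open scoped SchwartzMap
open MeasureTheory Filter Topology
open Literature.MathematicalPhysics.AQFT Literature.MathematicalPhysics.QuantumLattice
open Literature.MathematicalPhysics.QuantumFieldTheory
open Summit.QuantumFields.YangMills.Theorems.OSLegsFromFemtoAndGap (latticeDistStr)

namespace Summit.QuantumFields.YangMills.Cruxes.HypercubicLimit.CouplingResponse

section Objects

variable {G : Type} [Group G] [TopologicalSpace G] [IsTopologicalGroup G] [CompactSpace G]
  [MeasurableSpace G] [BorelSpace G]

/-- **The renormalised lattice distribution of a plane string** `q` at step `k`: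
`F ↦ (c_k a_k⁴)ⁿ Σ_{x ∈ (box L_k)ⁿ} W^{q}_k(x) F(a_k x)`, `W^{q}_k(x) = ∫ ∏ᵢ (p_{qᵢ}(τ_{xᵢ}Ũ) − m_k/6) dμ_k`. [folklore] -/
def planeDist (r : LatticeRep G) (sch : SpeciesScheme (YMSpecies G)) (k n : ℕ) (q : Fin n → Plane) :
    𝓢((Fin n → EuclideanSpace ℝ (Fin 4)), ℂ) →L[ℂ] ℂ :=
  (((sch.c r.curvature k * sch.a k ^ 4) ^ n : ℝ) : ℂ) •
    latticeDistStr r.ρ (sch.β k) (sch.L k) (sch.a k) (fun i => (planeSpecies r (q i)).F)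
      (fun _ => sch.m r.curvature k / 6)

/-- **`k`-uniform E0′-type bound on `⁰𝒮` for all plane strings**: one Schwartz index `s` and constants `α, β` with
`‖planeDist_k n q F‖ ≤ α (n!)^β |F|_{n s}` for every arity, string, off-diagonal test function and step. [folklore] -/
def UniformFunctionalBoundPlanes (r : LatticeRep G) (sch : SpeciesScheme (YMSpecies G)) : Prop :=
  ∃ (s : ℕ) (α β : ℝ), ∀ (n : ℕ) (q : Fin n → Plane) (F : 𝓢((Fin n → EuclideanSpace ℝ (Fin 4)), ℂ)),
    IsOffDiagonal F → ∀ k : ℕ, ‖planeDist r sch k n q F‖ ≤ α * (n.factorial : ℝ) ^ β * schwartzNorm (n * s) F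

/-- **Plane-string limits along a subsequence**: every renormalised plane-string distribution converges on `⁰𝒮` along `φ` to the
continuous linear functional `T n q`, and the limits obey one E0′-type bound on ALL test functions. [folklore] -/
def PlaneLimits (r : LatticeRep G) (sch : SpeciesScheme (YMSpecies G)) (φ : ℕ → ℕ)
    (T : (n : ℕ) → (Fin n → Plane) → (𝓢((Fin n → EuclideanSpace ℝ (Fin 4)), ℂ) →L[ℂ] ℂ)) : Prop :=
  (∀ (n : ℕ) (q : Fin n → Plane) (F : 𝓢((Fin n → EuclideanSpace ℝ (Fin 4)), ℂ)), IsOffDiagonal F →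
      Tendsto (fun k => planeDist r sch (φ k) n q F) atTop (𝓝 (T n q F))) ∧
  (∃ (s : ℕ) (α β : ℝ), ∀ (n : ℕ) (q : Fin n → Plane) (F : 𝓢((Fin n → EuclideanSpace ℝ (Fin 4)), ℂ)),
      ‖T n q F‖ ≤ α * (n.factorial : ℝ) ^ β * schwartzNorm (n * s) F)

end Objects

/-- **The candidate one-field Schwinger family of the curvature**: the sum of the plane-string limits over all strings. [folklore] -/
def planeSum (T : (n : ℕ) → (Fin n → Plane) → (𝓢((Fin n → EuclideanSpace ℝ (Fin 4)), ℂ) →L[ℂ] ℂ)) :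
    SchwingerFamily (EuclideanSpace ℝ (Fin 4)) :=
  fun n => ∑ q : Fin n → Plane, T n q

section Facts

variable {G : Type} [Group G] [TopologicalSpace G] [IsTopologicalGroup G] [CompactSpace G]
  [MeasurableSpace G] [BorelSpace G]

/-- The limits of a `PlaneLimits` package are unique on `⁰𝒮` (limits in a Hausdorff space). [folklore] -/
theorem PlaneLimits.eq_of_tendsto {r : LatticeRep G} {sch : SpeciesScheme (YMSpecies G)} {φ : ℕ → ℕ}
    {T : (n : ℕ) → (Fin n → Plane) → (𝓢((Fin n → EuclideanSpace ℝ (Fin 4)), ℂ) →L[ℂ] ℂ)}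
    (h : PlaneLimits r sch φ T) {n : ℕ} {q : Fin n → Plane} {F : 𝓢((Fin n → EuclideanSpace ℝ (Fin 4)), ℂ)}
    (hF : IsOffDiagonal F) {c : ℂ} (hc : Tendsto (fun k => planeDist r sch (φ k) n q F) atTop (𝓝 c)) :
    T n q F = c :=
  tendsto_nhds_unique (h.1 n q F hF) hc

/-- Along a `PlaneLimits` package the candidate family is the limit of the summed plane-string distributions on `⁰𝒮`. [folklore] -/
theorem PlaneLimits.tendsto_planeSum {r : LatticeRep G} {sch : SpeciesScheme (YMSpecies G)} {φ : ℕ → ℕ}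
    {T : (n : ℕ) → (Fin n → Plane) → (𝓢((Fin n → EuclideanSpace ℝ (Fin 4)), ℂ) →L[ℂ] ℂ)}
    (h : PlaneLimits r sch φ T) {n : ℕ} (F : 𝓢((Fin n → EuclideanSpace ℝ (Fin 4)), ℂ)) (hF : IsOffDiagonal F) :
    Tendsto (fun k => ∑ q : Fin n → Plane, planeDist r sch (φ k) n q F) atTop (𝓝 (planeSum T n F)) := by
  unfold planeSum
  rw [FunLike.coe_sum, Finset.sum_apply]
  exact tendsto_finsetSum _ fun q _ => h.1 n q F hF

end Facts

/-- **Registered sub-goal `planeSum_bound` (line `Sketch`, reshape 4 vocabulary)**: the candidate family inherits an E0′-type bound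
from the plane-string limits (`6ⁿ` strings). [folklore] -/
theorem planeSum_bound :
    ∀ (G : Type) [Group G] [TopologicalSpace G] [IsTopologicalGroup G] [CompactSpace G] [MeasurableSpace G] [BorelSpace G] (r : LatticeRep G) (sch : SpeciesScheme (YMSpecies G)) (φ : ℕ → ℕ) (T : (n : ℕ) → (Fin n → Plane) → (𝓢((Fin n → EuclideanSpace ℝ (Fin 4)), ℂ) →L[ℂ] ℂ)), PlaneLimits r sch φ T → ∃ (s : ℕ) (α β : ℝ), ∀ (n : ℕ) (F : 𝓢((Fin n → EuclideanSpace ℝ (Fin 4)), ℂ)), ‖planeSum T n F‖ ≤ α * (6 : ℝ) ^ n * (n.factorial : ℝ) ^ β * schwartzNorm (n * s) F := by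
  intro G _ _ _ _ _ _ r sch φ T h
  obtain ⟨s, α, β, hb⟩ := h.2
  refine ⟨s, α, β, fun n F => ?_⟩
  unfold planeSum
  rw [FunLike.coe_sum, Finset.sum_apply]
  refine (norm_sum_le _ _).trans ?_
  calc ∑ q : Fin n → Plane, ‖T n q F‖ ≤ ∑ _q : Fin n → Plane, α * (n.factorial : ℝ) ^ β * schwartzNorm (n * s) F :=
        Finset.sum_le_sum fun q _ => hb n q F
    _ = (6 : ℝ) ^ n * (α * (n.factorial : ℝ) ^ β * schwartzNorm (n * s) F) := by
        rw [Finset.sum_const, Finset.card_univ, Fintype.card_fun, Fintype.card_fin, nsmul_eq_mul]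
        have h6 : Fintype.card Plane = 6 := by decide
        rw [h6]
        push_cast
        ring
    _ = α * 6 ^ n * (n.factorial : ℝ) ^ β * schwartzNorm (n * s) F := by ring

end Summit.QuantumFields.YangMills.Cruxes.HypercubicLimit.CouplingResponse

end
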